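import Summits.KontsevichZagierPeriods.KontsevichZagierPeriods.Theorems.LinRedNormalFormWheelThreeSpokesCharts

/-!
# `WheelThreeSpokes` (stmt-KontsevichZagierPeriods-3913), line `laplacian-ldl-chart`:
the two level-one endgames inside the admissible words (`stub_wordCharts`)

On the typed simplex `S = {1 > t₀ > t₁ > t₂ > 0}` let `Z' = [S, 1/(t₀(1−t₁)(1−t₂))]` be any
`ζ(2,1)` word representation, `E₁ = [S, 1/(t₀(t₀−t₂)(1−t₁))]`, `E₂ = [S, t₂/(t₀(t₀−t₂)(1−t₂)t₁)]`.
* (`E₂`) ONE change of variables (rule 2) along the rational chart `C₂(t) = (t₁/t₀, t₂/t₀, t₂)`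
  of `S` onto itself (inverse `(b,p,q) ↦ (q/p, bq/p, q)`, `|J| = t₂/t₀³`), which pulls the
  `ζ(2,1)` word back to `E₂`: `[E₂] ≡ [Z']`;
* (`E₁`) ONE change of variables along `C₁(t) = (t₁/t₀, t₁, t₂/t₀)` of `S` onto
  `W = {0 < w₁ < w₀ < 1, 0 < w₂ < w₀}` (inverse `w ↦ (w₁/w₀, w₁, w₁w₂/w₀)`, `|J| = t₁/t₀³`),
  pulling `1/(w₀(1−w₁)(1−w₂))` (literally the `ζ(2,1)` word integrand) back to `E₁`; then
  `W = S ⊔ S⁽¹²⁾ ⊔ (W ∩ {w₁ = w₂})` (rule 1a, the wall being null), `S⁽¹²⁾` the image of `S`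
  under the coordinate swap `w₁ ↔ w₂`, which preserves the integrand (a `reindex` move, rule 2):
  `[E₁] ≡ [W] ≡ [Z'] + [Z'⁽¹²⁾] ≡ 2·[Z']`.
`E₁`, `E₂`, `[W, …]` EXIST because absolute integrability is transported along the charts, by
reindexing, and by union with a null wall from the given `Z'` (pattern of
`LinRedNormalFormBeukersZeta3.lean`). References: M. Kontsevich, D. Zagier, *Periods* (2001),
§1.2 rules (1), (2); D. Zagier, *Values of zeta functions and their applications* (1994), §9.
-/

noncomputable section

open Set MeasureTheory MvPolynomial
open Literature.NumberTheory.Transcendental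
open Literature.ModelTheory.ExponentialFields (IsSemialgebraic)

namespace Summit.KontsevichZagierPeriods.LinRedNormalForm.WheelThreeSpokes

/-! File-scoped notations (never global) for the sets, charts and integrands of the two moves, so
that the chart lemmas stay readable — the pattern of `LinRedNormalFormBeukersZeta3Charts.lean`. -/
local notation "DS" => setOf (fun t : Fin 3 → ℝ => 1 > t 0 ∧ t 0 > t 1 ∧ t 1 > t 2 ∧ t 2 > 0)
local notation "DW" =>
  setOf (fun w : Fin 3 → ℝ => 0 < w 1 ∧ w 1 < w 0 ∧ w 0 < 1 ∧ 0 < w 2 ∧ w 2 < w 0)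
local notation "DT" => setOf (fun w : Fin 3 → ℝ => 1 > w 0 ∧ w 0 > w 2 ∧ w 2 > w 1 ∧ w 1 > 0)
local notation "PE1" => (![X 1, X 1, X 2] : Fin 3 → MvPolynomial (Fin 3) ℚ)
local notation "QE1" => (![X 0, 1, X 0] : Fin 3 → MvPolynomial (Fin 3) ℚ)
local notation "PE2" => (![X 1, X 2, X 2] : Fin 3 → MvPolynomial (Fin 3) ℚ)
local notation "QE2" => (![X 0, X 0, 1] : Fin 3 → MvPolynomial (Fin 3) ℚ)
local notation "gZ" => (fun t : Fin 3 → ℝ => 1 / (t 0 * (1 - t 1) * (1 - t 2)))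
local notation "gE1" => (fun t : Fin 3 → ℝ => 1 / (t 0 * (t 0 - t 2) * (1 - t 1)))
local notation "gE2" => (fun t : Fin 3 → ℝ => t 2 / (t 0 * (t 0 - t 2) * (1 - t 2) * t 1))

namespace WordCharts

/-- Points of the simplex have `t₀ ≠ 0`. [folklore] -/
theorem apply_zero_ne_zero : ∀ y ∈ DS, y 0 ≠ 0 := by
  rintro y ⟨h0, h01, h12, h2⟩; apply ne_of_gt; linarith

/-- `t₀³ ≠ 0` on the simplex (the Jacobian denominator of both charts). [folklore] -/
theorem JQ_ne_zero : ∀ y ∈ DS, aeval y (X 0 ^ 3 : MvPolynomial (Fin 3) ℚ) ≠ 0 :=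
  fun y hy => by simpa using apply_zero_ne_zero y hy

/-- Values of the chart `C₂(t) = (t₁/t₀, t₂/t₀, t₂)`. [folklore] -/
theorem chartE2_apply (x : Fin 3 → ℝ) :
    (fun i => aeval x (PE2 i) / aeval x (QE2 i)) = ![x 1 / x 0, x 2 / x 0, x 2] := by
  funext i; fin_cases i <;> simp

/-- The denominators of `C₂` do not vanish on the simplex. [folklore] -/
theorem QE2_ne_zero : ∀ y ∈ DS, ∀ i, aeval y (QE2 i) ≠ 0 := by
  intro y hy i
  fin_cases i <;> simp [apply_zero_ne_zero y hy]

/-- Jacobian determinant of `C₂`: `t₂/t₀³`. [folklore] -/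
theorem det_chartE2 : ∀ y ∈ DS, (Matrix.of fun i j =>
      (aeval y (QE2 i))⁻¹ * aeval y (pderiv j (PE2 i)) -
        aeval y (PE2 i) / aeval y (QE2 i) ^ 2 * aeval y (pderiv j (QE2 i)) :
      Matrix (Fin 3) (Fin 3) ℝ).det =
      aeval y (X 2 : MvPolynomial (Fin 3) ℚ) / aeval y (X 0 ^ 3 : MvPolynomial (Fin 3) ℚ) := by
  intro y hy
  have hy0 := apply_zero_ne_zero y hy
  simp [Matrix.det_fin_three]
  field_simp

/-- `C₂` is injective on the simplex. [folklore] -/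
theorem injOn_chartE2 :
    InjOn (fun (x : Fin 3 → ℝ) (i : Fin 3) => aeval x (PE2 i) / aeval x (QE2 i)) DS := by
  rintro x ⟨hx0, hx01, hx12, hx2⟩ x' ⟨hx0', hx01', hx12', hx2'⟩ h
  have h0 := congrFun h 0
  have h1 := congrFun h 1
  have h2 := congrFun h 2
  simp only [Matrix.cons_val_zero, Matrix.cons_val_one, Matrix.cons_val_two, Matrix.head_cons,
    Matrix.tail_cons, map_one, aeval_X, div_one] at h0 h1 h2
  have hp : 0 < x 0 := by linarith
  have hp' : 0 < x' 0 := by linarith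
  have e0 : x 0 = x' 0 := by
    rw [h2, div_eq_div_iff hp.ne' hp'.ne'] at h1
    exact (mul_left_cancel₀ (ne_of_gt hx2') h1).symm
  have e1 : x 1 = x' 1 := by rwa [e0, div_left_inj' hp'.ne'] at h0
  funext i
  fin_cases i
  exacts [e0, e1, h2]

/-- `C₂` maps the simplex onto itself (inverse `(b,p,q) ↦ (q/p, bq/p, q)`). [folklore] -/
theorem image_chartE2 :
    (fun (x : Fin 3 → ℝ) (i : Fin 3) => aeval x (PE2 i) / aeval x (QE2 i)) '' DS = DS := by
  ext t
  constructor
  · rintro ⟨x, ⟨h0, h01, h12, h2⟩, rfl⟩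
    simp only [mem_setOf_eq, chartE2_apply, Matrix.cons_val_zero, Matrix.cons_val_one,
      Matrix.cons_val_two, Matrix.head_cons, Matrix.tail_cons, gt_iff_lt]
    have hx0 : 0 < x 0 := by linarith
    refine ⟨?_, ?_, ?_, h2⟩
    · rw [div_lt_one hx0]; exact h01
    · exact div_lt_div_of_pos_right h12 hx0
    · rw [lt_div_iff₀ hx0]; exact mul_lt_of_lt_one_right h2 h0
  · rintro ⟨h0, h01, h12, h2⟩
    have ht1 : 0 < t 1 := by linarith
    have ht0 : 0 < t 0 := by linarith
    refine ⟨![t 2 / t 1, t 0 * t 2 / t 1, t 2], ?_, ?_⟩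
    · simp only [mem_setOf_eq, Matrix.cons_val_zero, Matrix.cons_val_one, Matrix.cons_val_two,
        Matrix.head_cons, Matrix.tail_cons, gt_iff_lt]
      refine ⟨?_, ?_, ?_, h2⟩
      · rw [div_lt_one ht1]; exact h12
      · rw [div_lt_div_iff_of_pos_right ht1]; exact mul_lt_of_lt_one_left h2 h0
      · rw [lt_div_iff₀ ht1]; nlinarith [mul_lt_mul_of_pos_left h01 h2]
    · beta_reduce
      rw [chartE2_apply]
      funext i
      fin_cases i
      · show t 0 * t 2 / t 1 / (t 2 / t 1) = t 0
        field_simp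
      · show t 2 / (t 2 / t 1) = t 1
        field_simp
      · rfl

/-- Pull-back identity for `C₂`: `E₂ = (ζ(2,1)-word ∘ C₂)·|t₂/t₀³|` on the simplex. [folklore] -/
theorem hgh_chartE2 : ∀ y ∈ DS, gE2 y = gZ (fun i => aeval y (PE2 i) / aeval y (QE2 i)) *
      |aeval y (X 2 : MvPolynomial (Fin 3) ℚ) / aeval y (X 0 ^ 3 : MvPolynomial (Fin 3) ℚ)| := by
  rintro y ⟨h0, h01, h12, h2⟩
  rw [chartE2_apply]
  simp only [Matrix.cons_val_zero, Matrix.cons_val_one, Matrix.cons_val_two, Matrix.head_cons,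
    Matrix.tail_cons, map_pow, aeval_X]
  have hy1 : 0 < y 1 := by linarith
  have hy0 : 0 < y 0 := by linarith
  have h02 : 0 < y 0 - y 2 := by linarith
  have h2' : 0 < 1 - y 2 := by linarith
  rw [abs_of_pos (div_pos h2 (pow_pos hy0 3))]
  field_simp

/-- Values of the chart `C₁(t) = (t₁/t₀, t₁, t₂/t₀)`. [folklore] -/
theorem chartE1_apply (x : Fin 3 → ℝ) :
    (fun i => aeval x (PE1 i) / aeval x (QE1 i)) = ![x 1 / x 0, x 1, x 2 / x 0] := by
  funext i; fin_cases i <;> simp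

/-- The denominators of `C₁` do not vanish on the simplex. [folklore] -/
theorem QE1_ne_zero : ∀ y ∈ DS, ∀ i, aeval y (QE1 i) ≠ 0 := by
  intro y hy i
  fin_cases i <;> simp [apply_zero_ne_zero y hy]

/-- Jacobian determinant of `C₁`: `−t₁/t₀³`. [folklore] -/
theorem det_chartE1 : ∀ y ∈ DS, (Matrix.of fun i j =>
      (aeval y (QE1 i))⁻¹ * aeval y (pderiv j (PE1 i)) -
        aeval y (PE1 i) / aeval y (QE1 i) ^ 2 * aeval y (pderiv j (QE1 i)) :
      Matrix (Fin 3) (Fin 3) ℝ).det =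
      aeval y (-X 1 : MvPolynomial (Fin 3) ℚ) / aeval y (X 0 ^ 3 : MvPolynomial (Fin 3) ℚ) := by
  intro y hy
  have hy0 := apply_zero_ne_zero y hy
  simp [Matrix.det_fin_three]
  field_simp

/-- `C₁` is injective on the simplex. [folklore] -/
theorem injOn_chartE1 :
    InjOn (fun (x : Fin 3 → ℝ) (i : Fin 3) => aeval x (PE1 i) / aeval x (QE1 i)) DS := by
  rintro x ⟨hx0, hx01, hx12, hx2⟩ x' ⟨hx0', hx01', hx12', hx2'⟩ h
  have h0 := congrFun h 0
  have h1 := congrFun h 1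
  have h2 := congrFun h 2
  simp only [Matrix.cons_val_zero, Matrix.cons_val_one, Matrix.cons_val_two, Matrix.head_cons,
    Matrix.tail_cons, map_one, aeval_X, div_one] at h0 h1 h2
  have hp : 0 < x 0 := by linarith
  have hp' : 0 < x' 0 := by linarith
  have h1p : 0 < x' 1 := by linarith
  have e0 : x 0 = x' 0 := by
    rw [h1, div_eq_div_iff hp.ne' hp'.ne'] at h0
    exact (mul_left_cancel₀ h1p.ne' h0).symm
  have e2 : x 2 = x' 2 := by rwa [e0, div_left_inj' hp'.ne'] at h2
  funext i
  fin_cases i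
  exacts [e0, h1, e2]

/-- `C₁` maps the simplex onto `W = {0 < w₁ < w₀ < 1, 0 < w₂ < w₀}` (inverse
`w ↦ (w₁/w₀, w₁, w₁w₂/w₀)`). [folklore] -/
theorem image_chartE1 :
    (fun (x : Fin 3 → ℝ) (i : Fin 3) => aeval x (PE1 i) / aeval x (QE1 i)) '' DS = DW := by
  ext w
  constructor
  · rintro ⟨x, ⟨h0, h01, h12, h2⟩, rfl⟩
    simp only [mem_setOf_eq, chartE1_apply, Matrix.cons_val_zero, Matrix.cons_val_one,
      Matrix.cons_val_two, Matrix.head_cons, Matrix.tail_cons]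
    have hx1 : 0 < x 1 := by linarith
    have hx0 : 0 < x 0 := by linarith
    refine ⟨hx1, ?_, ?_, div_pos h2 hx0, div_lt_div_of_pos_right h12 hx0⟩
    · rw [lt_div_iff₀ hx0]; exact mul_lt_of_lt_one_right hx1 h0
    · rw [div_lt_one hx0]; exact h01
  · rintro ⟨h1, h10, h0, h2, h20⟩
    have hw0 : 0 < w 0 := by linarith
    refine ⟨![w 1 / w 0, w 1, w 1 * w 2 / w 0], ?_, ?_⟩
    · simp only [mem_setOf_eq, Matrix.cons_val_zero, Matrix.cons_val_one, Matrix.cons_val_two,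
        Matrix.head_cons, Matrix.tail_cons, gt_iff_lt]
      refine ⟨?_, ?_, ?_, div_pos (mul_pos h1 h2) hw0⟩
      · rw [div_lt_one hw0]; exact h10
      · rw [lt_div_iff₀ hw0]; exact mul_lt_of_lt_one_right h1 h0
      · rw [div_lt_iff₀ hw0]; exact mul_lt_mul_of_pos_left h20 h1
    · beta_reduce
      rw [chartE1_apply]
      funext i
      fin_cases i
      · show w 1 / (w 1 / w 0) = w 0
        field_simp
      · rfl
      · show w 1 * w 2 / w 0 / (w 1 / w 0) = w 2
        field_simp

/-- Pull-back identity for `C₁`: `E₁ = (ζ(2,1)-word ∘ C₁)·|−t₁/t₀³|` on the simplex. [folklore] -/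
theorem hgh_chartE1 : ∀ y ∈ DS, gE1 y = gZ (fun i => aeval y (PE1 i) / aeval y (QE1 i)) *
      |aeval y (-X 1 : MvPolynomial (Fin 3) ℚ) / aeval y (X 0 ^ 3 : MvPolynomial (Fin 3) ℚ)| := by
  rintro y ⟨h0, h01, h12, h2⟩
  rw [chartE1_apply]
  simp only [Matrix.cons_val_zero, Matrix.cons_val_one, Matrix.cons_val_two, Matrix.head_cons,
    Matrix.tail_cons, map_pow, map_neg, aeval_X, neg_div, abs_neg]
  have hy1 : 0 < y 1 := by linarith
  have hy0 : 0 < y 0 := by linarith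
  have h02 : 0 < y 0 - y 2 := by linarith
  have h1' : 0 < 1 - y 1 := by linarith
  rw [abs_of_pos (div_pos hy1 (pow_pos hy0 3))]
  field_simp

/-- `W` is `ℚ`-semialgebraic (five strict polynomial inequalities). [folklore] -/
theorem isSemialgebraic_DW : IsSemialgebraic ℚ DW := by
  have h := BeukersZeta3.isSemialgebraic_setOf_six_lt 0 (X 1) (X 1) (X 0) (X 0) 1 0 (X 2) (X 2)
    (X 0) 0 1
  simp only [map_zero, map_one, aeval_X, zero_lt_one, and_true] at h
  exact h

/-- The wall `{w₁ = w₂}` of `ℝ³` is Lebesgue-null. [folklore] -/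
theorem volume_wall : volume {w : Fin 3 → ℝ | w 1 = w 2} = 0 := by
  have h := ArrangementNormalForm.JanusBands.IntegrateOutLow.volume_setOf_aeval_eq
    (X 1 : MvPolynomial (Fin 3) ℚ) (X 2) ![0, 0, 1] (by simp)
  simpa using h

/-- Off `S` and its swap `S⁽¹²⁾`, a point of `W` lies on the wall `w₁ = w₂`. [folklore] -/
theorem DW_diff_subset : DW \ (DS ∪ DT) ⊆ {w : Fin 3 → ℝ | w 1 = w 2} := by
  rintro w ⟨⟨h1, h10, h0, h2, h20⟩, hn⟩
  simp only [mem_union, mem_setOf_eq, not_or] at hn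
  obtain ⟨hnS, hnT⟩ := hn
  rcases lt_trichotomy (w 1) (w 2) with hlt | heq | hgt
  · exact (hnT ⟨h0, h20, hlt, h1⟩).elim
  · exact heq
  · exact (hnS ⟨h0, h10, hgt, h2⟩).elim

/-- `S ∪ S⁽¹²⁾ ⊆ W`. [folklore] -/
theorem union_subset_DW : DS ∪ DT ⊆ DW := by
  rintro w (⟨h0, h01, h12, h2⟩ | ⟨h0, h02, h21, h1⟩)
  · exact ⟨by linarith, h01, h0, h2, by linarith⟩
  · exact ⟨h1, by linarith, h0, by linarith, h02⟩

/-- `S ∩ S⁽¹²⁾ = ∅`. [folklore] -/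
theorem DS_inter_DT : DS ∩ DT = ∅ := by
  ext w
  simp only [mem_inter_iff, mem_setOf_eq, mem_empty_iff_false, iff_false]
  rintro ⟨⟨-, -, h12, -⟩, ⟨-, -, h21, -⟩⟩
  linarith

/-- **The representation on `W` and the move `[W] ≡ 2·[Z']`**: from a `ζ(2,1)` word
representation `Z'` on `S`, `[W, 1/(w₀(1−w₁)(1−w₂))]` exists (integrable on `S` as `Z'`, on
`S⁽¹²⁾` as the reindexed `Z'`, the rest of `W` being the null wall `w₁ = w₂`), and
`[W] − 2·[Z'] ∈ relations`: shave the wall and split `S ⊔ S⁽¹²⁾` (rule 1a), identify the pieces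
with `Z'`, `Z'.reindex (swap 1 2)`, un-reindex (rule 2). [cite: KontsevichZagier2001, §1.2] -/
theorem exists_repW (z' : KZ.IntegralRep 3) (hz'd : z'.domain = DS)
    (hz'i : EqOn z'.integrand gZ z'.domain) :
    ∃ w : KZ.IntegralRep 3, w.domain = DW ∧ w.integrand = gZ ∧
      KZ.of w - 2 • KZ.of z' ∈ KZ.relations := by
  have hW : IsSemialgebraic ℚ DW := isSemialgebraic_DW
  have hS : IsSemialgebraic ℚ DS := isSemialgebraic_typedSimplex
  set zr : KZ.IntegralRep 3 := z'.reindex (Equiv.swap 1 2) with hzr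
  have hs0 : Equiv.swap (1 : Fin 3) 2 0 = 0 := by decide
  have hs1 : Equiv.swap (1 : Fin 3) 2 1 = 2 := Equiv.swap_apply_left _ _
  have hs2 : Equiv.swap (1 : Fin 3) 2 2 = 1 := Equiv.swap_apply_right _ _
  have hzrd : zr.domain = DT := by
    ext w
    rw [hzr, KZ.IntegralRep.reindex_domain, hz'd]
    simp only [mem_setOf_eq, hs0, hs1, hs2]
  have hzri : EqOn zr.integrand gZ zr.domain := by
    intro w hw
    rw [hzr, KZ.IntegralRep.reindex_integrand]
    have hw' : (fun i => w (Equiv.swap (1 : Fin 3) 2 i)) ∈ z'.domain := hw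
    simp only
    rw [hz'i hw']
    simp only [hs0, hs1, hs2]
    ring
  have hT : IsSemialgebraic ℚ DT := by rw [← hzrd]; exact zr.isSemialgebraic_domain
  have hi1 : IntegrableOn gZ DS := by
    have h := z'.integrableOn.congr_fun hz'i (KZ.IntegralRep.measurableSet_domain_holds z')
    rwa [hz'd] at h
  have hi2 : IntegrableOn gZ DT := by
    have h := zr.integrableOn.congr_fun hzri (KZ.IntegralRep.measurableSet_domain_holds zr)
    rwa [hzrd] at h
  have hnull : volume (DW \ (DS ∪ DT)) = 0 := measure_mono_null DW_diff_subset volume_wall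
  have hiN : IntegrableOn gZ (DW \ (DS ∪ DT)) := by
    rw [IntegrableOn, Measure.restrict_eq_zero.mpr hnull]
    exact integrable_zero_measure
  have hint : IntegrableOn gZ DW := by
    refine ((hi1.union hi2).union hiN).mono_set fun w hw => ?_
    by_cases h : w ∈ DS ∪ DT
    · exact Or.inl h
    · exact Or.inr ⟨hw, h⟩
  have hgsa : IsSemialgebraicFunOn ℚ DW gZ := by
    refine (isSemialgebraicFunOn_aeval_div_aeval hW (1 : MvPolynomial (Fin 3) ℚ)
      (X 0 * (1 - X 1) * (1 - X 2)) ?_).congr fun w _ => by simp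
    rintro w ⟨h1, h10, h0, h2, h20⟩
    have : 0 < w 0 := by linarith
    have : 0 < 1 - w 1 := by linarith
    have : 0 < 1 - w 2 := by linarith
    simp only [map_mul, map_sub, map_one, aeval_X]
    positivity
  let Wr : KZ.IntegralRep 3 := ⟨DW, gZ, hW, hgsa, hint⟩
  refine ⟨Wr, rfl, rfl, ?_⟩
  have hUsa : IsSemialgebraic ℚ (DS ∪ DT) := hS.union hT
  have hUsub : DS ∪ DT ⊆ Wr.domain := union_subset_DW
  have hSsub : DS ⊆ Wr.domain := fun w hw => hUsub (Or.inl hw)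
  have hTsub : DT ⊆ Wr.domain := fun w hw => hUsub (Or.inr hw)
  -- shave the null wall (rule 1a)
  have h1 : KZ.of Wr - KZ.of (Wr.restrict _ hUsa hUsub) ∈ KZ.relations :=
    Wr.of_sub_of_restrict_mem_relations hUsa hUsub hnull
  -- split `S ⊔ S⁽¹²⁾` (rule 1a)
  have h2 : KZ.of (Wr.restrict _ hUsa hUsub) - KZ.of (Wr.restrict _ hS hSsub) -
      KZ.of (Wr.restrict _ hT hTsub) ∈ KZ.relations := by
    refine KZ.domainAddRel_subset_relations ⟨3, Wr.restrict _ hUsa hUsub, Wr.restrict _ hS hSsub,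
      Wr.restrict _ hT hTsub, rfl, ?_, fun _ _ => rfl, fun _ _ => rfl, rfl⟩
    rw [KZ.IntegralRep.domain_restrict, KZ.IntegralRep.domain_restrict, DS_inter_DT, measure_empty]
  have h3 : KZ.of (Wr.restrict _ hS hSsub) - KZ.of z' ∈ KZ.relations := by
    refine KZ.of_sub_of_mem_relations_of_eqOn (by rw [KZ.IntegralRep.domain_restrict, hz'd])
      fun w hw => ?_
    have hw' : w ∈ z'.domain := by rw [hz'd]; exact hw
    rw [KZ.IntegralRep.integrand_restrict, hz'i hw']
  have h4 : KZ.of (Wr.restrict _ hT hTsub) - KZ.of zr ∈ KZ.relations := by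
    refine KZ.of_sub_of_mem_relations_of_eqOn (by rw [KZ.IntegralRep.domain_restrict, hzrd])
      fun w hw => ?_
    have hw' : w ∈ zr.domain := by rw [hzrd]; exact hw
    rw [KZ.IntegralRep.integrand_restrict, hzri hw']
  have h5 : KZ.of z' - KZ.of zr ∈ KZ.relations := KZ.of_sub_of_reindex_mem_relations z' _
  have : KZ.of Wr - 2 • KZ.of z' = (KZ.of Wr - KZ.of (Wr.restrict _ hUsa hUsub)) +
      (KZ.of (Wr.restrict _ hUsa hUsub) - KZ.of (Wr.restrict _ hS hSsub) -
        KZ.of (Wr.restrict _ hT hTsub)) +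
      (KZ.of (Wr.restrict _ hS hSsub) - KZ.of z') + (KZ.of (Wr.restrict _ hT hTsub) - KZ.of zr) -
      (KZ.of z' - KZ.of zr) := by abel
  rw [this]
  exact KZ.relations.sub_mem (KZ.relations.add_mem (KZ.relations.add_mem
    (KZ.relations.add_mem h1 h2) h3) h4) h5

end WordCharts

open WordCharts in
/-- **stub_wordCharts**: the two level-one endgames on the simplex `1 > t₀ > t₁ > t₂ > 0`.
(E₁) the rational chart `t ↦ (t₁/t₀, t₁, t₂/t₀)` (rule 2, `|J| = t₁/t₀³`) maps the simplex onto
`W = {0 < w₁ < w₀ < 1, 0 < w₂ < w₀}` and pulls `1/(w₀(1−w₁)(1−w₂))` back to `E₁`; `W` splits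
along the null wall `w₁ = w₂` (rule 1a) into the `ζ(2,1)` word on the simplex and its image under
the coordinate swap `w₁ ↔ w₂` (a `reindex` move, rule 2), so `[E₁] ≡ 2·[ζ(2,1)-word]`; (E₂) the
rational chart `t ↦ (t₁/t₀, t₂/t₀, t₂)` (`|J| = t₂/t₀³`) maps the simplex onto itself and pulls
the `ζ(2,1)` word back to `E₂`, so `[E₂] ≡ [ζ(2,1)-word]`. [cite: KontsevichZagier2001, §1.2] -/
theorem stub_wordCharts :
    (∀ z' : KZ.IntegralRep 3, z'.domain = {t : Fin 3 → ℝ | 1 > t 0 ∧ t 0 > t 1 ∧ t 1 > t 2 ∧ t 2 > 0} →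
      Set.EqOn z'.integrand (fun t => 1 / (t 0 * (1 - t 1) * (1 - t 2))) z'.domain →
      ∃ e₁ : KZ.IntegralRep 3, e₁.domain = {t : Fin 3 → ℝ | 1 > t 0 ∧ t 0 > t 1 ∧ t 1 > t 2 ∧ t 2 > 0} ∧
        e₁.integrand = fun t => 1 / (t 0 * (t 0 - t 2) * (1 - t 1))) ∧
    (∀ e₁ z' : KZ.IntegralRep 3, e₁.domain = {t : Fin 3 → ℝ | 1 > t 0 ∧ t 0 > t 1 ∧ t 1 > t 2 ∧ t 2 > 0} →
      Set.EqOn e₁.integrand (fun t => 1 / (t 0 * (t 0 - t 2) * (1 - t 1))) e₁.domain →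
      z'.domain = {t : Fin 3 → ℝ | 1 > t 0 ∧ t 0 > t 1 ∧ t 1 > t 2 ∧ t 2 > 0} →
      Set.EqOn z'.integrand (fun t => 1 / (t 0 * (1 - t 1) * (1 - t 2))) z'.domain →
      KZ.of e₁ - 2 • KZ.of z' ∈ KZ.relations) ∧
    (∀ z' : KZ.IntegralRep 3, z'.domain = {t : Fin 3 → ℝ | 1 > t 0 ∧ t 0 > t 1 ∧ t 1 > t 2 ∧ t 2 > 0} →
      Set.EqOn z'.integrand (fun t => 1 / (t 0 * (1 - t 1) * (1 - t 2))) z'.domain →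
      ∃ e₂ : KZ.IntegralRep 3, e₂.domain = {t : Fin 3 → ℝ | 1 > t 0 ∧ t 0 > t 1 ∧ t 1 > t 2 ∧ t 2 > 0} ∧
        e₂.integrand = fun t => t 2 / (t 0 * (t 0 - t 2) * (1 - t 2) * t 1)) ∧
    (∀ e₂ z' : KZ.IntegralRep 3, e₂.domain = {t : Fin 3 → ℝ | 1 > t 0 ∧ t 0 > t 1 ∧ t 1 > t 2 ∧ t 2 > 0} →
      Set.EqOn e₂.integrand (fun t => t 2 / (t 0 * (t 0 - t 2) * (1 - t 2) * t 1)) e₂.domain →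
      z'.domain = {t : Fin 3 → ℝ | 1 > t 0 ∧ t 0 > t 1 ∧ t 1 > t 2 ∧ t 2 > 0} →
      Set.EqOn z'.integrand (fun t => 1 / (t 0 * (1 - t 1) * (1 - t 2))) z'.domain →
      KZ.of e₂ - KZ.of z' ∈ KZ.relations) := by
  have T1 := ratChart_transport PE1 QE1 (-X 1) (X 0 ^ 3) isSemialgebraic_typedSimplex QE1_ne_zero
    JQ_ne_zero det_chartE1 injOn_chartE1 gE1 gZ hgh_chartE1
  rw [image_chartE1] at T1
  have T2 := ratChart_transport PE2 QE2 (X 2) (X 0 ^ 3) isSemialgebraic_typedSimplex QE2_ne_zero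
    JQ_ne_zero det_chartE2 injOn_chartE2 gE2 gZ hgh_chartE2
  rw [image_chartE2] at T2
  refine ⟨fun z' hz'd hz'i => ?_, fun e₁ z' he₁d he₁i hz'd hz'i => ?_, T2.1,
    fun e₂ z' he₂d he₂i hz'd hz'i => T2.2.2 e₂ z' he₂d (he₂d ▸ he₂i) hz'd hz'i⟩
  · obtain ⟨w, hwd, hwi, -⟩ := exists_repW z' hz'd hz'i
    exact T1.1 w hwd (by rw [hwi]; exact fun _ _ => rfl)
  · obtain ⟨w, hwd, hwi, hwrel⟩ := exists_repW z' hz'd hz'i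
    have h := T1.2.2 e₁ w he₁d (he₁d ▸ he₁i) hwd (by rw [hwi]; exact fun _ _ => rfl)
    have : KZ.of e₁ - 2 • KZ.of z' = (KZ.of e₁ - KZ.of w) + (KZ.of w - 2 • KZ.of z') := by abel
    rw [this]
    exact KZ.relations.add_mem h hwrel

end Summit.KontsevichZagierPeriods.LinRedNormalForm.WheelThreeSpokes
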